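import Literature.NumberTheory.NumberFields.CyclicQuinticField241ClassNumber
import Mathlib.NumberTheory.NumberField.Units.DirichletTheorem
import Mathlib.Data.Sign.Basic
import HarnessLib

/-!
# The cyclic quintic field of conductor `241`: `2`-adic reductions, units modulo squares, real signs

Sixth file on `K = K₂₄₁` (`CyclicQuinticField241*.lean`: `𝓞 K ≅ PeriodRing241 ℤ`, `Gal = ⟨σ⟩`, five
real embeddings `emb s : θ ↦ r s`, class number one). It prepares the `2`-descent of `480a1` over
`K` (`CyclicQuinticField241Descent.lean`), in which `2 = 𝔭₀𝔭₁𝔭₂𝔭₃𝔭₄` SPLITS COMPLETELY. Everything is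
PROVED (kernel computations in the order of periods and in `ℤ/8`):

* **the five reductions `ρ s : 𝓞 K → ℤ/8`** (`= 𝓞 K/𝔭ₛ³`): the period system
  `ηₖ ↦ (6, 4, 0, 2, 3)_{k+s}` in `ℤ/8` (`isPeriodSystem_e8`) and the universal property of the order;
  `ρ s ∘ σ = ρ (s + 1)` (`ρ_σint`);
* **the unit `v = -957η₀ - 981η₁ - 1053η₂ - 803η₃ - 999η₄`** (`N v = 1`, inverse
  `121843η₀ + 154035η₁ + 143187η₂ + 172877η₃ + 175153η₄`), its conjugates `unitv i = σⁱ v`, the `32`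
  representatives `rep n = (-1)^{b₄} ∏_{i<4} (σⁱv)^{bᵢ}` and their `2`-adic signatures
  `dsig (rep n) = dsigOf n ∈ ((ℤ/8)ˣ)⁵`, pairwise distinct (`dsigOf_injective`, by `decide`);
* **`(𝓞 K)ˣ/(𝓞 K)ˣ² = {rep n}`** (`exists_eq_rep_mul_sq`): Dirichlet's theorem bounds the number of
  classes by `2 · 2⁴ = 32`, squares have trivial signature, and `32` signatures are realised; in
  particular a unit of trivial `2`-adic signature is a square (`exists_sq_eq_of_dsig_eq_one`);
* **`σ` shifts the real places**: `emb s ∘ σ = emb (s + 1)` (`emb s (σθ)` is a root of `f` in the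
  isolating interval of `r (s+1)`), so `emb s (Σ yₖ ηₖ) = Σ yₖ r_{k+s}` (`emb_liftK`) and
  `∏ₛ emb s z = N(z)` (`prod_emb_eq_norm`);
* **the real signs of `v`**: `(-, -, +, +, +)` at `emb 0, …, emb 4` (`sign_emb_v`; four by interval
  arithmetic, the fifth — `|emb 0 v| ≈ 10⁻⁶` — from `N v = 1`).

## References

* D. A. Marcus, *Number Fields*, 2nd ed. (2018), Ch. 5, Thm. 38 (Dirichlet's unit theorem). [folklore]
* J. H. Silverman, *The Arithmetic of Elliptic Curves*, 2nd ed., GTM 106 (2009), §X.1 (the data of a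
  `2`-descent: units modulo squares, local classes at the primes above `2`). [folklore]
* T. Dokchitser, V. Dokchitser, J. Number Theory 131 (2011) 1833–1839, proof of Thm. 2.
  [DokchitserDokchitser2011RankModN]
-/

noncomputable section

open Polynomial NumberField

namespace Literature.NumberTheory.NumberFields

namespace CyclicQuintic241

open PeriodRing241 (eta shift const normP trP)

/-! ### `σ` on `𝓞 K` -/

/-- **`σ` restricted to `𝓞 K`** (a ring automorphism). [folklore] -/
def σint : 𝓞 K ≃+* 𝓞 K := RingOfIntegers.mapRingEquiv σ.toRingEquiv

/-- `σint` is `σ` on `K`. [folklore] -/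
@[simp] theorem coe_σint (a : 𝓞 K) : ((σint a : 𝓞 K) : K) = σ (a : K) := rfl

/-- `σ (Σ yₖ ηₖ) = Σ yₖ ηₖ₊₁` on `𝓞 K`: `σint ∘ liftO = liftO ∘ shift`. [folklore] -/
theorem σint_liftO (y : PeriodRing241 ℤ) : σint (liftO y) = liftO (shift y) := by
  apply RingOfIntegers.ext
  rw [coe_σint, coe_liftO, coe_liftO, liftK_shift]

/-- Iterates: `σⁿ (liftO y) = liftO (shiftⁿ y)`. [folklore] -/
theorem σint_iterate_liftO (n : ℕ) (y : PeriodRing241 ℤ) : σint^[n] (liftO y) = liftO (shift^[n] y) := by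
  induction n generalizing y with
  | zero => rfl
  | succ n ih => rw [Function.iterate_succ_apply, Function.iterate_succ_apply, σint_liftO, ih]

/-- `σint` iterated is `σ` iterated, on `K`. [folklore] -/
theorem coe_σint_iterate (n : ℕ) (a : 𝓞 K) : ((σint^[n] a : 𝓞 K) : K) = σ^[n] (a : K) := by
  induction n generalizing a with
  | zero => rfl
  | succ n ih => rw [Function.iterate_succ_apply, Function.iterate_succ_apply, ih, coe_σint]

/-! ### The five reductions `ρ s : 𝓞 K → ℤ/8` -/

/-- The `2`-adic residues of the periods modulo `8` along the prime `𝔭₀`: `ηₖ ↦ (6, 4, 0, 2, 3)ₖ`.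
[folklore] -/
def base8 : Fin 5 → ZMod 8 := ![6, 4, 0, 2, 3]

/-- The residues along `𝔭ₛ`: `ηₖ ↦ base8 (k + s)`. [folklore] -/
def e8 (s : Fin 5) (k : Fin 5) : ZMod 8 := base8 (k + s)

/-- **`e8 s` is a period system in `ℤ/8`** (the five `2`-adic roots of the period equations modulo `8`,
`2` splitting completely in `K`): kernel check of the fifteen relations. [folklore] -/
theorem isPeriodSystem_e8 (s : Fin 5) : PeriodRing241.IsPeriodSystem (e8 s) := by
  fin_cases s <;> exact
    { sum_eq := by decide, h00 := by decide, h01 := by decide, h02 := by decide, h03 := by decide,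
      h04 := by decide, h11 := by decide, h12 := by decide, h13 := by decide, h14 := by decide,
      h22 := by decide, h23 := by decide, h24 := by decide, h33 := by decide, h34 := by decide,
      h44 := by decide }

/-- The reduction of the order of periods along `𝔭ₛ`. [folklore] -/
def ρP (s : Fin 5) : PeriodRing241 ℤ →+* ZMod 8 := PeriodRing241.lift (isPeriodSystem_e8 s)

/-- `ρP s ηₖ = base8 (k + s)`. [folklore] -/
theorem ρP_eta (s k : Fin 5) : ρP s (eta k) = base8 (k + s) :=
  PeriodRing241.lift_eta (isPeriodSystem_e8 s) k

/-- **`ρ s : 𝓞 K → ℤ/8`**, the reduction modulo `𝔭ₛ³` (`𝓞 K ≅ PeriodRing241 ℤ`). [folklore] -/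
def ρ (s : Fin 5) : 𝓞 K →+* ZMod 8 := (ρP s).comp integerEquiv.symm.toRingHom

/-- `ρ s (liftO y) = ρP s y`. [folklore] -/
@[simp] theorem ρ_liftO (s : Fin 5) (y : PeriodRing241 ℤ) : ρ s (liftO y) = ρP s y := by
  change ρP s (integerEquiv.symm (integerEquiv y)) = ρP s y
  rw [RingEquiv.symm_apply_apply]

/-- `ρP s ∘ shift = ρP (s + 1)`. [folklore] -/
theorem ρP_shift (s : Fin 5) (y : PeriodRing241 ℤ) : ρP s (shift y) = ρP (s + 1) y := by
  have h : (ρP s).comp shift = ρP (s + 1) :=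
    PeriodRing241.ringHom_ext fun k => by
      rw [RingHom.comp_apply, PeriodRing241.shift_eta, ρP_eta, ρP_eta, add_assoc, add_comm 1 s]
  exact RingHom.congr_fun h y

/-- **`ρ s ∘ σ = ρ (s + 1)`** (`σ` permutes the primes above `2` cyclically). [folklore] -/
theorem ρ_σint (s : Fin 5) (z : 𝓞 K) : ρ s (σint z) = ρ (s + 1) z := by
  obtain ⟨y, rfl⟩ := liftO_surjective z
  rw [σint_liftO, ρ_liftO, ρ_liftO, ρP_shift]

/-- `ρ s (σᵏ z) = ρ (s + k) z` (`k < 5`). [folklore] -/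
theorem ρ_σint_iterate (k s : Fin 5) (z : 𝓞 K) : ρ s (σint^[(k : ℕ)] z) = ρ (s + k) z := by
  fin_cases k
  · simp
  · simpa using ρ_σint s z
  · show ρ s (σint^[2] z) = ρ (s + 2) z
    simp only [Function.iterate_succ_apply', Function.iterate_zero_apply, ρ_σint]
    rw [show (s + 1 + 1 : Fin 5) = s + 2 by omega]
  · show ρ s (σint^[3] z) = ρ (s + 3) z
    simp only [Function.iterate_succ_apply', Function.iterate_zero_apply, ρ_σint]
    rw [show (s + 1 + 1 + 1 : Fin 5) = s + 3 by omega]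
  · show ρ s (σint^[4] z) = ρ (s + 4) z
    simp only [Function.iterate_succ_apply', Function.iterate_zero_apply, ρ_σint]
    rw [show (s + 1 + 1 + 1 + 1 : Fin 5) = s + 4 by omega]

/-! ### The unit `v` and its conjugates; representatives of units modulo squares -/

/-- `v = -957η₀ - 981η₁ - 1053η₂ - 803η₃ - 999η₄` in the order of periods (a unit of norm `1`). [folklore] -/
def vP : PeriodRing241 ℤ := ⟨-957, -981, -1053, -803, -999⟩

/-- `v⁻¹ = 121843η₀ + 154035η₁ + 143187η₂ + 172877η₃ + 175153η₄` (the product of the other four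
conjugates). [folklore] -/
def vinvP : PeriodRing241 ℤ := ⟨121843, 154035, 143187, 172877, 175153⟩

/-- `v · v⁻¹ = 1` (kernel identity). [folklore] -/
theorem vP_mul_vinvP : vP * vinvP = 1 := by
  decide +kernel

/-- `N(v) = 1` (kernel computation of the norm form). [folklore] -/
theorem normP_vP : normP vP = const 1 := by
  decide +kernel

/-- **The unit `v ∈ (𝓞 K)ˣ`.** [folklore] -/
def unitv0 : (𝓞 K)ˣ :=
  Units.mkOfMulEqOne (liftO vP) (liftO vinvP) (by rw [← map_mul, vP_mul_vinvP, map_one])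

/-- `σ` on units of `𝓞 K`. [folklore] -/
def σunit : (𝓞 K)ˣ →* (𝓞 K)ˣ := Units.map σint.toRingHom.toMonoidHom

/-- **The conjugate units `unitv i = σⁱ v`**, `i < 5`. [folklore] -/
def unitv (i : Fin 5) : (𝓞 K)ˣ := σunit^[i] unitv0

/-- `unitv i = liftO (shiftⁱ v)` in `𝓞 K`. [folklore] -/
theorem coe_unitv (i : Fin 5) : ((unitv i : (𝓞 K)ˣ) : 𝓞 K) = liftO (shift^[(i : ℕ)] vP) := by
  rw [unitv, ← σint_iterate_liftO]
  generalize (i : ℕ) = n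
  induction n with
  | zero => rfl
  | succ n ih => rw [Function.iterate_succ_apply', Function.iterate_succ_apply', ← ih]; rfl

/-- The `i`-th binary digit of `n < 32`. [folklore] -/
def bit (n : Fin 32) (i : Fin 5) : ℕ := (n : ℕ) / 2 ^ (i : ℕ) % 2

/-- **The `32` representatives** `rep n = (-1)^{b₄} ∏_{i<4} (σⁱ v)^{bᵢ}`, `b = bits of n`. [folklore] -/
def rep (n : Fin 32) : (𝓞 K)ˣ :=
  (-1) ^ bit n 4 * ∏ i : Fin 4, unitv (Fin.castSucc i) ^ bit n (Fin.castSucc i)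

/-- `rep 0 = 1`. [folklore] -/
theorem rep_zero : rep 0 = 1 := by
  simp [rep, bit]

/-! ### `2`-adic signatures -/

/-- **The `2`-adic signature** of a unit: its residues along `𝔭₀, …, 𝔭₄` modulo `8`. [folklore] -/
def dsig (u : (𝓞 K)ˣ) : Fin 5 → ZMod 8 := fun s => ρ s (u : 𝓞 K)

/-- The signature is multiplicative. [folklore] -/
theorem dsig_mul (u w : (𝓞 K)ˣ) : dsig (u * w) = dsig u * dsig w := by
  ext s; simp only [dsig, Units.val_mul, map_mul, Pi.mul_apply]

/-- `dsig 1 = 1`. [folklore] -/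
theorem dsig_one : dsig 1 = 1 := by
  ext s; simp [dsig]

/-- `dsig` as a monoid homomorphism. [folklore] -/
def dsigHom : (𝓞 K)ˣ →* (Fin 5 → ZMod 8) where
  toFun := dsig
  map_one' := dsig_one
  map_mul' := dsig_mul

/-- `dsigHom` is `dsig`. [folklore] -/
@[simp] theorem dsigHom_apply (u : (𝓞 K)ˣ) : dsigHom u = dsig u := rfl

/-- Units of `ℤ/8` square to `1`. [folklore] -/
theorem units_mul_self_zmod8 : ∀ U : (ZMod 8)ˣ, (U : ZMod 8) * U = 1 := by
  decide

/-- **Squares of units have trivial signature**: `dsig (η²) = 1`. [folklore] -/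
theorem dsig_sq (η : (𝓞 K)ˣ) : dsig (η ^ 2) = 1 := by
  ext s
  have h := units_mul_self_zmod8 (Units.map (ρ s : 𝓞 K →* ZMod 8) η)
  simp only [Units.coe_map, MonoidHom.coe_coe] at h
  simp only [dsig, sq, Units.val_mul, map_mul, Pi.one_apply]
  exact h

/-- `dsig (-1) = -1`. [folklore] -/
theorem dsig_neg_one : dsig (-1) = -1 := by
  ext s; simp [dsig]

/-- The residues of `v` along `𝔭₀, …, 𝔭₄`: `(3, 7, 1, 5, 1)`. [folklore] -/
def vres : Fin 5 → ZMod 8 := ![3, 7, 1, 5, 1]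

/-- `ρP s (shiftⁱ v) = vres (s + i)` (kernel computation). [folklore] -/
theorem ρP_shift_iterate_vP : ∀ s i : Fin 5, ρP s (shift^[(i : ℕ)] vP) = vres (s + i) := by
  decide +kernel

/-- **The signature of the conjugate units**: `dsig (σⁱ v) s = vres (s + i)`. [folklore] -/
theorem dsig_unitv (i s : Fin 5) : dsig (unitv i) s = vres (s + i) := by
  rw [dsig, coe_unitv, ρ_liftO, ρP_shift_iterate_vP]

/-- The predicted signature of `rep n` (computable). [folklore] -/
def dsigOf (n : Fin 32) (s : Fin 5) : ZMod 8 :=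
  (-1) ^ bit n 4 * ∏ i : Fin 4, vres (s + Fin.castSucc i) ^ bit n (Fin.castSucc i)

/-- **`dsig (rep n) = dsigOf n`.** [folklore] -/
theorem dsig_rep (n : Fin 32) : dsig (rep n) = dsigOf n := by
  ext s
  rw [rep, ← dsigHom_apply, map_mul, map_pow, map_prod, Pi.mul_apply, Pi.pow_apply,
    Finset.prod_apply, dsigHom_apply, dsig_neg_one]
  simp only [map_pow, Pi.pow_apply, dsigHom_apply, dsig_unitv, dsigOf, Pi.neg_apply, Pi.one_apply]

/-- **The `32` signatures are pairwise distinct** (kernel computation over `32 × 32` pairs): the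
conjugates of `v` and `-1` are independent modulo squares. [folklore] -/
theorem dsigOf_injective : Function.Injective dsigOf := by
  have h : ∀ n m : Fin 32, dsigOf n = dsigOf m → n = m := by decide +kernel
  exact fun n m hnm => h n m hnm

/-- `dsigOf 0 = 1`. [folklore] -/
theorem dsigOf_zero : dsigOf 0 = 1 := by
  decide +kernel

/-! ### Units modulo squares (Dirichlet) -/

/-- For a quintic field the unit rank is at most `4`. [folklore] -/
theorem units_rank_le_four : Units.rank K ≤ 4 := by
  have h1 := InfinitePlace.card_add_two_mul_card_eq_rank K
  have h2 := InfinitePlace.card_eq_nrRealPlaces_add_nrComplexPlaces K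
  rw [finrank_K] at h1
  rw [Units.rank, h2]
  omega

/-- **Units modulo squares (Dirichlet).** Every unit is `ρ(e) η²` with
`ρ(s, ε) = (-1)^s ∏ᵢ εᵢ^{εᵢ'}` over Mathlib's fundamental system (`i < rank K`), `s, εᵢ' ∈ {0, 1}`.
(Verbatim the tree's `CyclicQuintic11.exists_fund_rep_mul_sq`.) [folklore] -/
theorem exists_fund_rep_mul_sq (x : (𝓞 K)ˣ) :
    ∃ (s : Fin 2) (ε : Fin (Units.rank K) → Fin 2) (η : (𝓞 K)ˣ),
      x = ((-1) ^ (s : ℕ) * ∏ i, Units.fundSystem K i ^ ((ε i : ℕ))) * η ^ 2 := by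
  classical
  obtain ⟨⟨ζ, e⟩, hx, -⟩ := Units.exist_unique_eq_mul_prod K x
  have hodd : Odd (Module.finrank ℚ K) := by rw [finrank_K]; decide
  refine ⟨if ((ζ : (𝓞 K)ˣ) = 1) then 0 else 1, fun i => ⟨(e i % 2).toNat, by omega⟩,
    ∏ i, Units.fundSystem K i ^ (e i / 2), ?_⟩
  have hsplit : ∀ i, Units.fundSystem K i ^ e i =
      Units.fundSystem K i ^ (((⟨(e i % 2).toNat, by omega⟩ : Fin 2) : ℕ)) *
        (Units.fundSystem K i ^ (e i / 2)) ^ 2 := by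
    intro i
    rw [← zpow_natCast, ← zpow_natCast (Units.fundSystem K i ^ (e i / 2)) 2, ← zpow_mul,
      ← zpow_add]
    congr 1
    push_cast
    rw [Int.toNat_of_nonneg (Int.emod_nonneg _ two_ne_zero)]
    omega
  rw [← Finset.prod_pow, mul_assoc, ← Finset.prod_mul_distrib]
  simp_rw [← hsplit]
  rcases Units.torsion_eq_one_or_neg_one_of_odd_finrank hodd ζ with hζ | hζ
  · rw [if_pos hζ]
    simp only [Fin.val_zero, pow_zero, one_mul]
    rw [hζ, one_mul] at hx
    exact hx
  · have hne : (ζ : (𝓞 K)ˣ) ≠ 1 := by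
      rw [hζ]
      intro h
      have h' := congrArg (fun u : (𝓞 K)ˣ => (u : 𝓞 K)) h
      simp only [Units.val_neg, Units.val_one] at h'
      norm_num at h'
    rw [if_neg hne]
    simp only [Fin.val_one, pow_one]
    rw [hζ] at hx
    exact hx

/-- **The signature classifies units modulo squares.** By Dirichlet every unit is `ρ(e) η²` for one
of at most `2 · 2⁴ = 32` elements `ρ(e)`; the `rep n` realise `32` distinct signatures, so every
signature of a unit is some `dsigOf n`, and a unit of trivial signature is a square. [folklore] -/
theorem dsig_classifies (x : (𝓞 K)ˣ) :
    (∃ n : Fin 32, dsig x = dsigOf n) ∧ (dsig x = 1 → ∃ η : (𝓞 K)ˣ, x = η ^ 2) := by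
  classical
  set F := Units.fundSystem K with hF
  let E := Fin 2 × (Fin (Units.rank K) → Fin 2)
  let ρ' : E → (𝓞 K)ˣ := fun e => (-1) ^ (e.1 : ℕ) * ∏ i, F i ^ ((e.2 i : ℕ))
  have hρ0 : ρ' (0, fun _ => 0) = 1 := by simp [ρ']
  have hcardE : Fintype.card E ≤ 32 := by
    have hr := units_rank_le_four
    simp only [E, Fintype.card_prod, Fintype.card_fun, Fintype.card_fin]
    calc 2 * 2 ^ Units.rank K ≤ 2 * 2 ^ 4 :=
          Nat.mul_le_mul_left 2 (Nat.pow_le_pow_right (by norm_num) hr)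
      _ = 32 := by norm_num
  let T : Finset (Fin 5 → ZMod 8) := Finset.univ.image dsigOf
  have hTcard : T.card = 32 := by
    rw [Finset.card_image_of_injective _ dsigOf_injective]
    simp
  have hred : ∀ y : (𝓞 K)ˣ, ∃ e : E, dsig y = dsig (ρ' e) := by
    intro y
    obtain ⟨s, ε, η, hy⟩ := exists_fund_rep_mul_sq y
    exact ⟨(s, ε), by rw [hy, dsig_mul, dsig_sq, mul_one]⟩
  have hsurjT : T ⊆ Finset.univ.image (dsig ∘ ρ') := by
    intro w hw
    rw [Finset.mem_image] at hw ⊢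
    obtain ⟨n, -, rfl⟩ := hw
    obtain ⟨e, he⟩ := hred (rep n)
    exact ⟨e, Finset.mem_univ e, by rw [Function.comp_apply, ← he, dsig_rep]⟩
  have hle : (Finset.univ.image (dsig ∘ ρ')).card ≤ T.card :=
    calc (Finset.univ.image (dsig ∘ ρ')).card ≤ (Finset.univ : Finset E).card := Finset.card_image_le
      _ = Fintype.card E := Finset.card_univ
      _ ≤ 32 := hcardE
      _ = T.card := hTcard.symm
  have himage : T = Finset.univ.image (dsig ∘ ρ') := Finset.eq_of_subset_of_card_le hsurjT hle
  have hinj : Set.InjOn (dsig ∘ ρ') (Finset.univ : Finset E) := by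
    rw [← Finset.card_image_iff]
    apply le_antisymm Finset.card_image_le
    calc (Finset.univ : Finset E).card = Fintype.card E := Finset.card_univ
      _ ≤ 32 := hcardE
      _ = T.card := hTcard.symm
      _ ≤ (Finset.univ.image (dsig ∘ ρ')).card := Finset.card_le_card hsurjT
  obtain ⟨s, ε, η, hxe⟩ := exists_fund_rep_mul_sq x
  have hxsig : dsig x = dsig (ρ' (s, ε)) := by rw [hxe, dsig_mul, dsig_sq, mul_one]
  refine ⟨?_, fun hx => ?_⟩
  · have hmem : dsig x ∈ T := by
      rw [himage, Finset.mem_image]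
      exact ⟨(s, ε), Finset.mem_univ _, hxsig.symm⟩
    obtain ⟨n, -, hn⟩ := Finset.mem_image.mp hmem
    exact ⟨n, hn.symm⟩
  · have hρe : (dsig ∘ ρ') (s, ε) = (dsig ∘ ρ') (0, fun _ => 0) := by
      rw [Function.comp_apply, Function.comp_apply, hρ0, dsig_one, ← hxsig, hx]
    have he0 : (s, ε) = (0, fun _ => 0) := hinj (Finset.mem_univ _) (Finset.mem_univ _) hρe
    refine ⟨η, ?_⟩
    rw [hxe, show ((-1) ^ (s : ℕ) * ∏ i, F i ^ ((ε i : ℕ)) : (𝓞 K)ˣ) = ρ' (s, ε) from rfl, he0, hρ0,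
      one_mul]

/-- **A unit of trivial `2`-adic signature is a square.** [folklore] -/
theorem exists_sq_eq_of_dsig_eq_one (x : (𝓞 K)ˣ) (hx : dsig x = 1) : ∃ η : (𝓞 K)ˣ, x = η ^ 2 :=
  (dsig_classifies x).2 hx

/-- Group-theoretic bookkeeping: `x R = η²` gives `x = R (η R⁻¹)²`. [folklore] -/
theorem eq_mul_sq_of_mul_eq_sq' {G : Type*} [CommGroup G] {x R η : G} (h : x * R = η ^ 2) :
    x = R * (η * R⁻¹) ^ 2 := by
  rw [mul_pow, inv_pow, ← h, ← mul_assoc, mul_comm R (x * R), mul_assoc x R R, ← pow_two,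
    mul_inv_cancel_right]

/-- Every value of `dsigOf` consists of odd residues, which square to `1`. [folklore] -/
theorem dsigOf_mul_self : ∀ n : Fin 32, dsigOf n * dsigOf n = 1 := by
  decide +kernel

/-- **Every unit of `K` is `rep n` times a square** (`n < 32`). [folklore] -/
theorem exists_eq_rep_mul_sq (x : (𝓞 K)ˣ) : ∃ (n : Fin 32) (η : (𝓞 K)ˣ), x = rep n * η ^ 2 := by
  obtain ⟨n, hn⟩ := (dsig_classifies x).1
  have hsq : dsig (x * rep n) = 1 := by
    rw [dsig_mul, dsig_rep, hn, dsigOf_mul_self]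
  obtain ⟨η, hη⟩ := exists_sq_eq_of_dsig_eq_one _ hsq
  exact ⟨n, η * (rep n)⁻¹, eq_mul_sq_of_mul_eq_sq' hη⟩

/-! ### `σ` shifts the real places: `emb s ∘ σ = emb (s + 1)` -/

/-- `emb s (σθ)` is a root of `p` (the image of the root `σθ = e241 1` of `f`). [folklore] -/
theorem preal_emb_e241_one (s : Fin 5) : preal (emb s (e241 1)) = 0 := by
  have h := congrArg (emb s) aeval_e241_one
  rw [map_zero, aeval_def, Polynomial.hom_eval₂, RingHom.ext_rat ((emb s).comp (algebraMap ℚ K))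
    (algebraMap ℚ ℝ), eval₂_quinticPolyRat_eq_preal] at h
  exact h

/-- `emb s (σθ) = P₁(r s)/176`. [folklore] -/
theorem emb_e241_one_eq_div (s : Fin 5) :
    emb s (e241 1) = (736 + 400 * r s + (-318) * r s ^ 2 + (-21) * r s ^ 3 + 5 * r s ^ 4) / 176 := by
  simp only [e241, map_div₀, map_add, map_mul, map_pow, map_neg, map_ofNat, emb_θ]

/-- Powers of a real number in a non-negative interval. [folklore] -/
theorem pow_bounds_pos {lo hi x : ℝ} (h0 : 0 ≤ lo) (h1 : lo < x) (h2 : x < hi) :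
    lo ^ 2 < x ^ 2 ∧ x ^ 2 < hi ^ 2 ∧ lo ^ 3 < x ^ 3 ∧ x ^ 3 < hi ^ 3 ∧ lo ^ 4 < x ^ 4 ∧ x ^ 4 < hi ^ 4 := by
  have hx : 0 ≤ x := h0.trans h1.le
  exact ⟨pow_lt_pow_left₀ h1 h0 two_ne_zero, pow_lt_pow_left₀ h2 hx two_ne_zero,
    pow_lt_pow_left₀ h1 h0 three_ne_zero, pow_lt_pow_left₀ h2 hx three_ne_zero,
    pow_lt_pow_left₀ h1 h0 four_ne_zero, pow_lt_pow_left₀ h2 hx four_ne_zero⟩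

/-- Powers of a real number in a non-positive interval. [folklore] -/
theorem pow_bounds_neg {lo hi x : ℝ} (h0 : hi ≤ 0) (h1 : lo < x) (h2 : x < hi) :
    hi ^ 2 < x ^ 2 ∧ x ^ 2 < lo ^ 2 ∧ lo ^ 3 < x ^ 3 ∧ x ^ 3 < hi ^ 3 ∧ hi ^ 4 < x ^ 4 ∧ x ^ 4 < lo ^ 4 := by
  have hb := pow_bounds_pos (lo := -hi) (hi := -lo) (x := -x) (by linarith) (by linarith) (by linarith)
  simp only [neg_sq, Even.neg_pow (by decide : Even 4), Odd.neg_pow (by decide : Odd 3)] at hb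
  exact ⟨hb.1, hb.2.1, by linarith [hb.2.2.1], by linarith [hb.2.2.2.1], hb.2.2.2.2.1, hb.2.2.2.2.2⟩

/-- `emb 0 (e241 1) = r 1` (`σ` shifts the real places). [folklore] -/
theorem emb_e241_one_0 : emb 0 (e241 1) = r₁ := by
  have hv := emb_e241_one_eq_div 0
  have hs := r₀_spec.1
  simp only [Set.mem_Ioo] at hs
  rw [show r 0 = r₀ from rfl] at hv
  have hb := pow_bounds_pos (show (0:ℝ) ≤ 972074374 / 100000000 by norm_num) hs.1 hs.2
  norm_num at hb
  rcases root_cases (preal_emb_e241_one 0) with h | h | h | h | h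
  · exfalso
    have hj := r₀_spec.1
    simp only [Set.mem_Ioo] at hj
    rw [h] at hv
    nlinarith [hj.1, hj.2, hb.1, hb.2.1, hb.2.2.1, hb.2.2.2.1, hb.2.2.2.2.1, hb.2.2.2.2.2, hs.1, hs.2]
  · exact h
  · exfalso
    have hj := r₂_spec.1
    simp only [Set.mem_Ioo] at hj
    rw [h] at hv
    nlinarith [hj.1, hj.2, hb.1, hb.2.1, hb.2.2.1, hb.2.2.2.1, hb.2.2.2.2.1, hb.2.2.2.2.2, hs.1, hs.2]
  · exfalso
    have hj := r₃_spec.1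
    simp only [Set.mem_Ioo] at hj
    rw [h] at hv
    nlinarith [hj.1, hj.2, hb.1, hb.2.1, hb.2.2.1, hb.2.2.2.1, hb.2.2.2.2.1, hb.2.2.2.2.2, hs.1, hs.2]
  · exfalso
    have hj := r₄_spec.1
    simp only [Set.mem_Ioo] at hj
    rw [h] at hv
    nlinarith [hj.1, hj.2, hb.1, hb.2.1, hb.2.2.1, hb.2.2.2.1, hb.2.2.2.2.1, hb.2.2.2.2.2, hs.1, hs.2]

/-- `emb 1 (e241 1) = r 2` (`σ` shifts the real places). [folklore] -/
theorem emb_e241_one_1 : emb 1 (e241 1) = r₂ := by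
  have hv := emb_e241_one_eq_div 1
  have hs := r₁_spec.1
  simp only [Set.mem_Ioo] at hs
  rw [show r 1 = r₁ from rfl] at hv
  have hb := pow_bounds_neg (show (-39368115 / 100000000 : ℝ) ≤ 0 by norm_num) hs.1 hs.2
  norm_num at hb
  rcases root_cases (preal_emb_e241_one 1) with h | h | h | h | h
  · exfalso
    have hj := r₀_spec.1
    simp only [Set.mem_Ioo] at hj
    rw [h] at hv
    nlinarith [hj.1, hj.2, hb.1, hb.2.1, hb.2.2.1, hb.2.2.2.1, hb.2.2.2.2.1, hb.2.2.2.2.2, hs.1, hs.2]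
  · exfalso
    have hj := r₁_spec.1
    simp only [Set.mem_Ioo] at hj
    rw [h] at hv
    nlinarith [hj.1, hj.2, hb.1, hb.2.1, hb.2.2.1, hb.2.2.2.1, hb.2.2.2.2.1, hb.2.2.2.2.2, hs.1, hs.2]
  · exact h
  · exfalso
    have hj := r₃_spec.1
    simp only [Set.mem_Ioo] at hj
    rw [h] at hv
    nlinarith [hj.1, hj.2, hb.1, hb.2.1, hb.2.2.1, hb.2.2.2.1, hb.2.2.2.2.1, hb.2.2.2.2.2, hs.1, hs.2]
  · exfalso
    have hj := r₄_spec.1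
    simp only [Set.mem_Ioo] at hj
    rw [h] at hv
    nlinarith [hj.1, hj.2, hb.1, hb.2.1, hb.2.2.1, hb.2.2.2.1, hb.2.2.2.2.1, hb.2.2.2.2.2, hs.1, hs.2]

/-- `emb 2 (e241 1) = r 3` (`σ` shifts the real places). [folklore] -/
theorem emb_e241_one_2 : emb 2 (e241 1) = r₃ := by
  have hv := emb_e241_one_eq_div 2
  have hs := r₂_spec.1
  simp only [Set.mem_Ioo] at hs
  rw [show r 2 = r₂ from rfl] at hv
  have hb := pow_bounds_pos (show (0:ℝ) ≤ 301502139 / 100000000 by norm_num) hs.1 hs.2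
  norm_num at hb
  rcases root_cases (preal_emb_e241_one 2) with h | h | h | h | h
  · exfalso
    have hj := r₀_spec.1
    simp only [Set.mem_Ioo] at hj
    rw [h] at hv
    nlinarith [hj.1, hj.2, hb.1, hb.2.1, hb.2.2.1, hb.2.2.2.1, hb.2.2.2.2.1, hb.2.2.2.2.2, hs.1, hs.2]
  · exfalso
    have hj := r₁_spec.1
    simp only [Set.mem_Ioo] at hj
    rw [h] at hv
    nlinarith [hj.1, hj.2, hb.1, hb.2.1, hb.2.2.1, hb.2.2.2.1, hb.2.2.2.2.1, hb.2.2.2.2.2, hs.1, hs.2]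
  · exfalso
    have hj := r₂_spec.1
    simp only [Set.mem_Ioo] at hj
    rw [h] at hv
    nlinarith [hj.1, hj.2, hb.1, hb.2.1, hb.2.2.1, hb.2.2.2.1, hb.2.2.2.2.1, hb.2.2.2.2.2, hs.1, hs.2]
  · exact h
  · exfalso
    have hj := r₄_spec.1
    simp only [Set.mem_Ioo] at hj
    rw [h] at hv
    nlinarith [hj.1, hj.2, hb.1, hb.2.1, hb.2.2.1, hb.2.2.2.1, hb.2.2.2.2.1, hb.2.2.2.2.2, hs.1, hs.2]

/-- `emb 3 (e241 1) = r 4` (`σ` shifts the real places). [folklore] -/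
theorem emb_e241_one_3 : emb 3 (e241 1) = r₄ := by
  have hv := emb_e241_one_eq_div 3
  have hs := r₃_spec.1
  simp only [Set.mem_Ioo] at hs
  rw [show r 3 = r₃ from rfl] at hv
  have hb := pow_bounds_neg (show (-631313174 / 100000000 : ℝ) ≤ 0 by norm_num) hs.1 hs.2
  norm_num at hb
  rcases root_cases (preal_emb_e241_one 3) with h | h | h | h | h
  · exfalso
    have hj := r₀_spec.1
    simp only [Set.mem_Ioo] at hj
    rw [h] at hv
    nlinarith [hj.1, hj.2, hb.1, hb.2.1, hb.2.2.1, hb.2.2.2.1, hb.2.2.2.2.1, hb.2.2.2.2.2, hs.1, hs.2]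
  · exfalso
    have hj := r₁_spec.1
    simp only [Set.mem_Ioo] at hj
    rw [h] at hv
    nlinarith [hj.1, hj.2, hb.1, hb.2.1, hb.2.2.1, hb.2.2.2.1, hb.2.2.2.2.1, hb.2.2.2.2.2, hs.1, hs.2]
  · exfalso
    have hj := r₂_spec.1
    simp only [Set.mem_Ioo] at hj
    rw [h] at hv
    nlinarith [hj.1, hj.2, hb.1, hb.2.1, hb.2.2.1, hb.2.2.2.1, hb.2.2.2.2.1, hb.2.2.2.2.2, hs.1, hs.2]
  · exfalso
    have hj := r₃_spec.1
    simp only [Set.mem_Ioo] at hj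
    rw [h] at hv
    nlinarith [hj.1, hj.2, hb.1, hb.2.1, hb.2.2.1, hb.2.2.2.1, hb.2.2.2.2.1, hb.2.2.2.2.2, hs.1, hs.2]
  · exact h

/-- `emb 4 (e241 1) = r 0` (`σ` shifts the real places). [folklore] -/
theorem emb_e241_one_4 : emb 4 (e241 1) = r₀ := by
  have hv := emb_e241_one_eq_div 4
  have hs := r₄_spec.1
  simp only [Set.mem_Ioo] at hs
  rw [show r 4 = r₄ from rfl] at hv
  have hb := pow_bounds_neg (show (-702895224 / 100000000 : ℝ) ≤ 0 by norm_num) hs.1 hs.2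
  norm_num at hb
  rcases root_cases (preal_emb_e241_one 4) with h | h | h | h | h
  · exact h
  · exfalso
    have hj := r₁_spec.1
    simp only [Set.mem_Ioo] at hj
    rw [h] at hv
    nlinarith [hj.1, hj.2, hb.1, hb.2.1, hb.2.2.1, hb.2.2.2.1, hb.2.2.2.2.1, hb.2.2.2.2.2, hs.1, hs.2]
  · exfalso
    have hj := r₂_spec.1
    simp only [Set.mem_Ioo] at hj
    rw [h] at hv
    nlinarith [hj.1, hj.2, hb.1, hb.2.1, hb.2.2.1, hb.2.2.2.1, hb.2.2.2.2.1, hb.2.2.2.2.2, hs.1, hs.2]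
  · exfalso
    have hj := r₃_spec.1
    simp only [Set.mem_Ioo] at hj
    rw [h] at hv
    nlinarith [hj.1, hj.2, hb.1, hb.2.1, hb.2.2.1, hb.2.2.2.1, hb.2.2.2.2.1, hb.2.2.2.2.2, hs.1, hs.2]
  · exfalso
    have hj := r₄_spec.1
    simp only [Set.mem_Ioo] at hj
    rw [h] at hv
    nlinarith [hj.1, hj.2, hb.1, hb.2.1, hb.2.2.1, hb.2.2.2.1, hb.2.2.2.2.1, hb.2.2.2.2.2, hs.1, hs.2]

/-- **`emb s (σθ) = r (s + 1)`.** [folklore] -/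
theorem emb_e241_one (s : Fin 5) : emb s (e241 1) = r (s + 1) := by
  fin_cases s
  exacts [emb_e241_one_0, emb_e241_one_1, emb_e241_one_2, emb_e241_one_3, emb_e241_one_4]

/-- **`emb s ∘ σ = emb (s + 1)`** (`σ` shifts the real places cyclically). [folklore] -/
theorem emb_comp_σ (s : Fin 5) : (emb s).comp (σ : K →+* K) = emb (s + 1) :=
  ringHom_real_ext (by rw [RingHom.comp_apply, RingHom.coe_coe, σ_θ, emb_e241_one, emb_θ])

/-- `emb s (σ x) = emb (s + 1) x`. [folklore] -/
theorem emb_σ (s : Fin 5) (x : K) : emb s (σ x) = emb (s + 1) x := by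
  have := congrArg (fun f : K →+* ℝ => f x) (emb_comp_σ s)
  simpa using this

/-- `emb s (σᵏ x) = emb (s + k) x` (`k < 5`). [folklore] -/
theorem emb_σ_iterate (k s : Fin 5) (x : K) : emb s (σ^[(k : ℕ)] x) = emb (s + k) x := by
  fin_cases k
  · simp
  · simpa using emb_σ s x
  · show emb s (σ^[2] x) = emb (s + 2) x
    simp only [Function.iterate_succ_apply', Function.iterate_zero_apply, emb_σ]
    rw [show (s + 1 + 1 : Fin 5) = s + 2 by omega]
  · show emb s (σ^[3] x) = emb (s + 3) x
    simp only [Function.iterate_succ_apply', Function.iterate_zero_apply, emb_σ]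
    rw [show (s + 1 + 1 + 1 : Fin 5) = s + 3 by omega]
  · show emb s (σ^[4] x) = emb (s + 4) x
    simp only [Function.iterate_succ_apply', Function.iterate_zero_apply, emb_σ]
    rw [show (s + 1 + 1 + 1 + 1 : Fin 5) = s + 4 by omega]

/-- `emb s (e241 k) = r (s + k)`. [folklore] -/
theorem emb_e241 (s k : Fin 5) : emb s (e241 k) = r (s + k) := by
  rw [← σ_iterate_θ, emb_σ_iterate, emb_θ]

/-- **The real embeddings on the period coordinates**: `emb s (Σ yₖ ηₖ) = Σ yₖ r_{s+k}`. [folklore] -/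
theorem emb_liftK (s : Fin 5) (y : PeriodRing241 ℤ) :
    emb s (liftK y) = y.c0 * r s + y.c1 * r (s + 1) + y.c2 * r (s + 2) + y.c3 * r (s + 3) +
      y.c4 * r (s + 4) := by
  rw [liftK, PeriodRing241.lift_apply, PeriodRing241.liftFun]
  simp only [map_add, map_mul, map_intCast, emb_e241, add_zero]

/-- **`∏ₛ emb s z = N(z)`**: the norm is the product over the real places. [folklore] -/
theorem prod_emb_eq_norm (z : K) : ∏ s : Fin 5, emb s z = Algebra.norm ℚ z := by
  have h := congrArg (emb 0) (norm_eq_prod_pow_σ z)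
  rw [map_prod] at h
  have h' : (emb 0) (algebraMap ℚ K (Algebra.norm ℚ z)) = (Algebra.norm ℚ z : ℝ) := by
    rw [← RingHom.comp_apply, RingHom.ext_rat ((emb 0).comp (algebraMap ℚ K)) (algebraMap ℚ ℝ)]
    rfl
  rw [h'] at h
  rw [h]
  refine Finset.prod_congr rfl fun s _ => ?_
  rw [σ_pow_apply, emb_σ_iterate, zero_add]

/-! ### The real signs of `v` -/

/-- **The signs of `v` at the five real places**: `emb s v < 0` for `s = 0, 1` and `> 0` for
`s = 2, 3, 4`. Four of them by interval arithmetic on `Σ vₖ r_{s+k}` (roots known to `10⁻⁸`); at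
`s = 0`, where `|emb 0 v| ≈ 1.3·10⁻⁶`, from `∏ₛ emb s v = N(v) = 1`. [folklore] -/
theorem sign_emb_v :
    emb 0 (liftK vP) < 0 ∧ emb 1 (liftK vP) < 0 ∧ 0 < emb 2 (liftK vP) ∧ 0 < emb 3 (liftK vP) ∧
      0 < emb 4 (liftK vP) := by
  have h0 := r₀_spec.1; have h1 := r₁_spec.1; have h2 := r₂_spec.1; have h3 := r₃_spec.1
  have h4 := r₄_spec.1
  simp only [Set.mem_Ioo] at h0 h1 h2 h3 h4
  have e1 : emb 1 (liftK vP) < 0 := by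
    rw [emb_liftK]; simp [vP, r, Fin.isValue]; linarith
  have e2 : 0 < emb 2 (liftK vP) := by
    rw [emb_liftK]; simp [vP, r, Fin.isValue]; linarith
  have e3 : 0 < emb 3 (liftK vP) := by
    rw [emb_liftK]; simp [vP, r, Fin.isValue]; linarith
  have e4 : 0 < emb 4 (liftK vP) := by
    rw [emb_liftK]; simp [vP, r, Fin.isValue]; linarith
  have hprod : ∏ s : Fin 5, emb s (liftK vP) = 1 := by
    rw [prod_emb_eq_norm, norm_liftK_of_normP_eq normP_vP, Int.cast_one, Rat.cast_one]
  rw [Fin.prod_univ_five] at hprod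
  refine ⟨?_, e1, e2, e3, e4⟩
  by_contra hge
  rw [not_lt] at hge
  have h01 : emb 0 (liftK vP) * emb 1 (liftK vP) ≤ 0 := mul_nonpos_iff.mpr (Or.inl ⟨hge, e1.le⟩)
  have h234 : 0 < emb 2 (liftK vP) * emb 3 (liftK vP) * emb 4 (liftK vP) := mul_pos (mul_pos e2 e3) e4
  have hle : emb 0 (liftK vP) * emb 1 (liftK vP) * (emb 2 (liftK vP) * emb 3 (liftK vP) * emb 4 (liftK vP)) ≤ 0 :=
    mul_nonpos_iff.mpr (Or.inr ⟨h01, h234.le⟩)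
  have heq : emb 0 (liftK vP) * emb 1 (liftK vP) * (emb 2 (liftK vP) * emb 3 (liftK vP) * emb 4 (liftK vP)) = 1 := by
    rw [← hprod]; ring
  linarith

end CyclicQuintic241

end Literature.NumberTheory.NumberFields

end
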